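import Summits.AnomalousDissipation.AnomalousDissipation.Theorems.MomentLadder.Negative.Clauses
import Literature.Analysis.FunctionSpaces.TorusEnstrophyTrilinear
import Literature.Analysis.FunctionSpaces.TorusTruncationH1
import Literature.Analysis.FluidPDE.ZerothLaw

/-!
# Resolution ⇒ UI: stub `stub_resolutionUI` of line `Sketch`
# (crux `MomentParity.MomentLadder`, stmt-AnomalousDissipation-11463)

Stub B2 of the skeleton (the converse A4 of the card): a `κ`-resolved probability law `μ` on
`H = L²_σ(T³)` supported in the ball `‖u‖ ≤ R` has the explicit uniform-integrability modulus
`∫_{Z > 8π²κ(n)²R²} Z dμ ≤ 2/(n+1)` for the enstrophy `Z = ‖∇u‖²`.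

Proof: Bernstein in the ball gives `Z(P_K u) ≤ 4π²K²‖u‖² ≤ 4π²K²R² =: L` for `μ`-a.e. `u`
(`eGradNormSq_fourierTruncate_le_sq_mul`), and `Z(P_K u) ≤ Z u` pointwise
(`Torus.eGradNormSq_fourierTruncate_le`). Splitting the resolution inequality
`∫ Z ≤ ∫ Z∘P_K + (n+1)⁻¹` over `S = {Z > 2L}` and `Sᶜ` and cancelling the finite `∫_{Sᶜ} Z` gives
`∫_S Z ≤ L μ(S) + (n+1)⁻¹`, while `2L μ(S) ≤ ∫_S Z`; hence `∫_S Z ≤ 2 (n+1)⁻¹`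
(`setLIntegral_le_two_mul_of_resolved`, pure measure theory on a probability space).
-/

set_option linter.dupNamespace false

noncomputable section

namespace Summit.AnomalousDissipation.AnomalousDissipation.Theorems.MomentLadder

open MeasureTheory Filter Topology Set
open scoped ENNReal NNReal InnerProductSpace RealInnerProductSpace Polynomial
open Literature.Analysis.FunctionSpaces Literature.Analysis.FluidPDE
open Summit.AnomalousDissipation.AnomalousDissipation.Theses.MomentParity
open Summit.AnomalousDissipation.AnomalousDissipation.Theorems.QuarticGate.Negative
open Summit.AnomalousDissipation.AnomalousDissipation.Theorems.MomentLadder.Negative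

/-! ## The measure-theoretic core: a resolved, a.e.-capped minorant forces a UI modulus -/

/-- **Cancellation lemma.** On a probability space, let `Z, W : α → ℝ≥0∞` with `W ≤ Z` pointwise,
`W ≤ L < ∞` a.e., `Z` measurable, and `∫ Z ≤ ∫ W + δ` with `δ < ∞`. Then the mass of `Z` above the
level `2L` is at most `2δ`: `∫_{Z > 2L} Z dμ ≤ 2δ`. Indeed, splitting both integrals over
`S = {Z > 2L}` and `Sᶜ` and cancelling the finite `∫_{Sᶜ} Z ≥ ∫_{Sᶜ} W` gives
`∫_S Z ≤ L μ(S) + δ ≤ (∫_S Z)/2 + δ`. [folklore] -/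
theorem setLIntegral_le_two_mul_of_resolved {α : Type*} [MeasurableSpace α] {μ : Measure α}
    [IsProbabilityMeasure μ] {Z W : α → ℝ≥0∞} (hZm : Measurable Z) {L δ : ℝ≥0∞} (hL : L ≠ ⊤)
    (hδ : δ ≠ ⊤) (ha : ∀ᵐ x ∂μ, W x ≤ L) (hb : ∀ x, W x ≤ Z x)
    (hres : ∫⁻ x, Z x ∂μ ≤ (∫⁻ x, W x ∂μ) + δ) :
    ∫⁻ x in {x | 2 * L < Z x}, Z x ∂μ ≤ 2 * δ := by
  set S : Set α := {x | 2 * L < Z x} with hS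
  have hSm : MeasurableSet S := measurableSet_lt measurable_const hZm
  -- (c) finiteness of `∫ Z`
  have hWle : ∫⁻ x, W x ∂μ ≤ L := by
    calc ∫⁻ x, W x ∂μ ≤ ∫⁻ _, L ∂μ := lintegral_mono_ae ha
      _ = L := by rw [lintegral_const, measure_univ, mul_one]
  have hZT : ∫⁻ x, Z x ∂μ ≠ ⊤ :=
    ne_top_of_le_ne_top (ENNReal.add_ne_top.2 ⟨hL, hδ⟩) (hres.trans (add_le_add hWle le_rfl))
  have hAT : ∫⁻ x in S, Z x ∂μ ≠ ⊤ := ne_top_of_le_ne_top hZT (setLIntegral_le_lintegral _ _)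
  have hBT : ∫⁻ x in Sᶜ, Z x ∂μ ≠ ⊤ := ne_top_of_le_ne_top hZT (setLIntegral_le_lintegral _ _)
  -- (d) split over `S` and `Sᶜ` and cancel `∫_{Sᶜ} Z`
  have hWS : ∫⁻ x in S, W x ∂μ ≤ L * μ S := by
    calc ∫⁻ x in S, W x ∂μ ≤ ∫⁻ _ in S, L ∂μ := lintegral_mono_ae (ae_restrict_of_ae ha)
      _ = L * μ S := setLIntegral_const _ _
  have hWSc : ∫⁻ x in Sᶜ, W x ∂μ ≤ ∫⁻ x in Sᶜ, Z x ∂μ := lintegral_mono fun x => hb x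
  have hd : ∫⁻ x in S, Z x ∂μ ≤ L * μ S + δ := by
    refine ENNReal.le_of_add_le_add_right hBT ?_
    calc (∫⁻ x in S, Z x ∂μ) + ∫⁻ x in Sᶜ, Z x ∂μ = ∫⁻ x, Z x ∂μ := lintegral_add_compl Z hSm
      _ ≤ (∫⁻ x, W x ∂μ) + δ := hres
      _ = (∫⁻ x in S, W x ∂μ) + (∫⁻ x in Sᶜ, W x ∂μ) + δ := by rw [lintegral_add_compl W hSm]
      _ ≤ L * μ S + (∫⁻ x in Sᶜ, Z x ∂μ) + δ := add_le_add (add_le_add hWS hWSc) le_rfl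
      _ = L * μ S + δ + ∫⁻ x in Sᶜ, Z x ∂μ := by ring
  -- (e) on `S` the integrand exceeds `2L`
  have he : 2 * L * μ S ≤ ∫⁻ x in S, Z x ∂μ := by
    calc 2 * L * μ S = ∫⁻ _ in S, 2 * L ∂μ := (setLIntegral_const _ _).symm
      _ ≤ ∫⁻ x in S, Z x ∂μ := lintegral_mono_ae ((ae_restrict_mem hSm).mono fun x hx => le_of_lt hx)
  -- (f) combine: `A + A ≤ A + 2δ` with `A < ∞`
  refine ENNReal.le_of_add_le_add_left hAT ?_
  calc (∫⁻ x in S, Z x ∂μ) + ∫⁻ x in S, Z x ∂μ = 2 * ∫⁻ x in S, Z x ∂μ := (two_mul _).symm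
    _ ≤ 2 * (L * μ S + δ) := mul_le_mul' le_rfl hd
    _ = 2 * L * μ S + 2 * δ := by ring
    _ ≤ (∫⁻ x in S, Z x ∂μ) + 2 * δ := add_le_add he le_rfl

/-! ## Bernstein in the ball -/

/-- Bernstein in the ball: if `‖u‖ ≤ R` (`u ∈ H`) then `Z(P_K u) ≤ 4π²K²R²` in `ℝ≥0∞`
(`eGradNormSq_fourierTruncate_le_sq_mul` and `‖u‖² ≤ R²`). [folklore] -/
theorem eGradNormSq_fourierTruncate_le_of_mem_ball (K : ℕ) {R : ℝ} (u : Torus.energySpace (Fin 3))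
    (hu : ‖u‖ ≤ R) :
    Torus.eGradNormSq (Torus.fourierTruncate K (u.1 : UnitAddTorus (Fin 3) → EuclideanSpace ℝ (Fin 3))) ≤
      ENNReal.ofReal (4 * Real.pi ^ 2 * (K : ℝ) ^ 2 * R ^ 2) := by
  have h2 : ‖u.1‖ₑ ^ 2 ≤ ENNReal.ofReal (R ^ 2) := by
    rw [← ofReal_norm, ← ENNReal.ofReal_pow (norm_nonneg _), Submodule.norm_coe]
    exact ENNReal.ofReal_le_ofReal (pow_le_pow_left₀ (norm_nonneg _) hu 2)
  calc Torus.eGradNormSq (Torus.fourierTruncate K (u.1 : UnitAddTorus (Fin 3) → EuclideanSpace ℝ (Fin 3)))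
      ≤ ENNReal.ofReal (4 * Real.pi ^ 2 * (K : ℝ) ^ 2) * ‖u.1‖ₑ ^ 2 :=
        eGradNormSq_fourierTruncate_le_sq_mul K u.1
    _ ≤ ENNReal.ofReal (4 * Real.pi ^ 2 * (K : ℝ) ^ 2) * ENNReal.ofReal (R ^ 2) := mul_le_mul' le_rfl h2
    _ = ENNReal.ofReal (4 * Real.pi ^ 2 * (K : ℝ) ^ 2 * R ^ 2) := by
        rw [← ENNReal.ofReal_mul (by positivity)]

/-! ## The stub -/

/-- **B2: RESOLUTION ⇒ UI** (the converse A4 of the card): a `κ`-resolved probability law supported in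
`‖u‖ ≤ R` has the explicit UI modulus `∫_{Z > 8π²κ(n)²R²} Z dμ ≤ 2/(n+1)` (`Z(P_κ u) ≤ 4π²κ²R²` a.e. by
Bernstein in the ball and `Z(P_κ u) ≤ Z u`, so the cancellation lemma
`setLIntegral_le_two_mul_of_resolved` applies with `L = 4π²κ(n)²R²`, `δ = (n+1)⁻¹`). [folklore] -/
theorem stub_resolutionUI :
    ∀ (R : ℝ) (κ : ℕ → ℕ) (μ : Measure (Torus.energySpace (Fin 3))), IsProbabilityMeasure μ →
      IsSupported R μ → IsResolved κ μ → ∀ n : ℕ,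
        ∫⁻ u in {u : Torus.energySpace (Fin 3) |
            ENNReal.ofReal (8 * Real.pi ^ 2 * ((κ n : ℕ) : ℝ) ^ 2 * R ^ 2) <
              Torus.eGradNormSq (u.1 : UnitAddTorus (Fin 3) → EuclideanSpace ℝ (Fin 3))},
          Torus.eGradNormSq (u.1 : UnitAddTorus (Fin 3) → EuclideanSpace ℝ (Fin 3)) ∂μ ≤ 2 * ((n : ℝ≥0∞) + 1)⁻¹ := by
  intro R κ μ hP hsupp hres n
  have hT : ENNReal.ofReal (8 * Real.pi ^ 2 * ((κ n : ℕ) : ℝ) ^ 2 * R ^ 2) =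
      2 * ENNReal.ofReal (4 * Real.pi ^ 2 * ((κ n : ℕ) : ℝ) ^ 2 * R ^ 2) := by
    rw [← ENNReal.ofReal_ofNat 2, ← ENNReal.ofReal_mul (by norm_num)]
    congr 1
    ring
  rw [hT]
  have hδ : ((n : ℝ≥0∞) + 1)⁻¹ ≠ ⊤ := ENNReal.inv_ne_top.2 (by positivity)
  exact setLIntegral_le_two_mul_of_resolved
    (W := fun u : Torus.energySpace (Fin 3) => Torus.eGradNormSq (Torus.fourierTruncate (κ n)
      (u.1 : UnitAddTorus (Fin 3) → EuclideanSpace ℝ (Fin 3))))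
    Torus.measurable_eGradNormSq_coe ENNReal.ofReal_ne_top hδ
    (Filter.Eventually.mono hsupp fun u hu => eGradNormSq_fourierTruncate_le_of_mem_ball (κ n) u hu)
    (fun u => Torus.eGradNormSq_fourierTruncate_le ((Lp.memLp u.1).integrable one_le_two) (κ n))
    (hres n)

end Summit.AnomalousDissipation.AnomalousDissipation.Theorems.MomentLadder

end
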